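import Literature.AnabelianGeometry.EtaleTheta.Discharge.Sec4NonVacuityCoveringRoots
import Literature.AnabelianGeometry.EtaleTheta.Discharge.Sec4Prop42SubBaseLiftNegative
import Literature.AnabelianGeometry.EtaleTheta.Discharge.Sec4Prop42SubBaseLiftUpToUnit
import HarnessLib

/-!
# [EtTh] Prop 4.2 (iii), sub-node L03 vs L03′ at the Kummer-tower toy: the original L03 `BaseFrobeniusLift`
# is FALSE there (a non-trivial constant unit), the reshaped L03′ `BaseFrobeniusLiftUpToUnit` HOLDS

S. Mochizuki, *The étale theta function and its Frobenioid-theoretic manifestations*, Publ. RIMS **45**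
(2009) [MochizukiEtTh2009], §4, Prop 4.2 (iii) proof p.89 l.83 – p.90 l.6; [FrdI] Def 2.7 (i) (a base-section is
a skeleton: no unit `≠ 1` is `P`-distinguished).  Sub-DAG `plan/L2/SUBDAG-EtTh-Prop42.md` rows L03 (finding
F-w4d044-1, superseded) / L03′.

CONSISTENCY WITNESS, TOY.  PROOF-ONLY; instance requested in abc-iut-f-109's census hand-over (2026-08-26T07:13Z,
F-2796).  At `ToyCov.biKummerSetting` (p427822) the unit group `O^×(A_⊙) = ℂˣ` is non-trivial (`coefAut A_⊙ (-1) ≠ 1`,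
by `unitsToRatFn_coefUnit` + `cnstUnitHom_injective`), so abc-iut-w5-d134's `not_baseFrobeniusLift_mkOfModelCanonical`
FIRES: the sub-node L03 AS ORIGINALLY TYPED (`d.α₁ = φ` for a GIVEN pull-back morphism `φ`) is FALSE at a kernel
model through `mkOfModelCanonical` — while its reshaped form L03′ holds there (`baseFrobeniusLiftUpToUnit_mkOfModelCanonical`,
`Φ` divisorial) and Prop 4.2 (iii) itself holds (`ToyCov.prop42_iii`, p428415).  So the L2-lead's reshaping
L03 → L03′ (2026-08-26T03:05Z) was necessary, not cosmetic, kernel-checked at one setting.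
Nothing here bears on, or takes a side on, [IUTchIII] Cor. 3.12.
-/

noncomputable section

namespace Literature.AnabelianGeometry.EtaleTheta

open CategoryTheory Opposite Literature.AlgebraicGeometry.Frobenioids
open scoped NNRat

namespace ToyCov

/-- `A_⊙` has a non-trivial unit: multiplication by the constant `-1`. [cite: MochizukiFrdI2008, Thm. 5.2(ii) p.101] -/
theorem coefAut_neg_one_ne_one : coefAut Aodot (-1) ≠ 1 := by
  intro h
  have h1 : coefUnit Aodot (-1) = 1 := Subtype.ext h
  have h2 := congrArg (ModelFrobenioid.unitsToRatFn Aodot) h1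
  rw [unitsToRatFn_coefUnit, map_one, ← (cnstUnitHom Aodot).map_one] at h2
  have h3 : (-1 : ℂˣ) = 1 := cnstUnitHom_injective Aodot h2
  have h4 := congrArg (fun u : ℂˣ => (u : ℂ)) h3
  norm_num at h4

/-- **L03 `BaseFrobeniusLift` (as originally typed) is FALSE at the Kummer-tower toy** (abc-iut-w5-d134's
`not_baseFrobeniusLift_mkOfModelCanonical` on the non-trivial unit `-1 ∈ O^×(A_⊙)`) — **while L03′
`BaseFrobeniusLiftUpToUnit` HOLDS there** (`baseFrobeniusLiftUpToUnit_mkOfModelCanonical`, `Φ` divisorial).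
[cite: MochizukiEtTh2009, Prop 4.2 p.89] -/
theorem not_baseFrobeniusLift_and_baseFrobeniusLiftUpToUnit :
    ¬ BiKummerSetting.Prop42Sub.BaseFrobeniusLift biKummerSetting ∧
      BiKummerSetting.Prop42Sub.BaseFrobeniusLiftUpToUnit biKummerSetting :=
  ⟨BiKummerSetting.not_baseFrobeniusLift_mkOfModelCanonical Toy.temperedGroup temperedFrobenioid
      temperedFrobenioid_monoidType temperedFrobenioid_isPerfect (fun _ => True) (fun _ _ => 1)
      galoisSurj_surjective (fun _ _ _ => True) Aodot isFrobeniusTrivial_Aodot trivial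
      (u := coefAut Aodot (-1)) ⟨(coefAut_mem_units Aodot (-1)).1, (coefAut_mem_units Aodot (-1)).2⟩
      coefAut_neg_one_ne_one,
    BiKummerSetting.Prop42Sub.baseFrobeniusLiftUpToUnit_mkOfModelCanonical Toy.temperedGroup temperedFrobenioid
      temperedFrobenioid_monoidType temperedFrobenioid_isPerfect (fun _ => True) (fun _ _ => 1)
      galoisSurj_surjective (fun _ _ _ => True) Aodot isFrobeniusTrivial_Aodot trivial divisorMonoid_isDivisorial⟩

end ToyCov

end Literature.AnabelianGeometry.EtaleTheta

end
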